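import Summits.Ventures.Crystal3D.Theorems.StickyWulffConstantGenericWallFloorStackWalkWordSepTwo
import Summits.Ventures.Crystal3D.Theorems.StickyWulffConstantGenericWallFloorStackWalkForcedChain
import HarnessLib

/-!
# The RAY WORD of a grain and the level-`m` word law (crux `GenericWallFloor`, stmt-Ventures-19480, line `WallLedgerG`)

HONEST FRAMING. Venture `Summits/Ventures/Crystal3D` (cell `crystal3d-full`), helper `--supports` the crux
`GenericWallFloor` of `route-Ventures-StickyWulffConstant`, REGISTERED line `WallLedgerG`, open stub
`stub_twoSlabAdhesion`.  Rung credit only; F-C1 not moved; NOT the crux.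

`…StackWalkForcedChain` proved that a sound well-formed stack over a bottom `b` is a prefix of one of the two FORCED RAYS
`forcedTop z b n ·` (`n` = the first push normal).  This file turns that into the word calculus the cell files need, at
EVERY level at once (the tree had levels one and two: `inner_dir_getLast_stackWord`, `stackWord_lastTwo_ne{,_far}`):
* `rayStack z b n m` — the ray as a stack of depth `m`; `stack_eq_rayStack` — every sound well-formed stack IS
  `rayStack z b (firstNrm stk) depth` (`firstNrm_spec`: the first push normal is a unit menu normal of the bottom frame,
  positive on the bottom direction);
* `rayWord z b n m := stackWord (rayStack z b n m)` — the RAY WORD (model mirror letters, most recent first), with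
  `rayWord_succ`, `length_rayWord`, `rayWord_eq_append` (longer ray words extend shorter ones at the front);
* **`not_suffix_of_ray`** (the level-`m` law): if for both first push normals the depth-`m` ray word is not the given
  chain word `ch` (as mirror sequences), then NO stack word over `b` ends with `ch`'s mirrors;
* **`inner_dir_eq_zero_of_ray`** (the direction reading): if a stack's word IS the chain word `ch` and the depth-`(m+1)`
  ray words avoid `μ :: ch`, then the top direction lies in the mirror plane of `μ` (`⟪e.dir, μ⟫ = 0`) — the forced next
  normal `2√(2/3)·F d − n` is `±F μ` exactly when `⟪F d, F μ⟫ ≠ 0`.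
The hypotheses are finitely checkable per pair (two ray words of bounded depth).  Consumed by `…StackWalkRayCross`.
WHAT THIS IS NOT: not the stub; no counting; F-C1 not moved.
-/

noncomputable section

namespace Summit.Ventures.Crystal3D.Theorems

open Summit.Ventures.Crystal3D Finset
open Literature.MathematicalPhysics.StatisticalMechanics (fccStacking)
open scoped InnerProductSpace

variable {z : EuclideanSpace ℝ (Fin 3)}

/-! ### The ray as a stack -/

/-- The RAY STACK of depth `m` over the bottom `b` with first push normal `n`: `[b]` at depth `0`, and the ray entry
`forcedTop z b n m` pushed on top at depth `m + 1`. -/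
def rayStack (z : EuclideanSpace ℝ (Fin 3)) (b : WalkEntry) (n : EuclideanSpace ℝ (Fin 3)) : ℕ → List WalkEntry
  | 0 => [b]
  | m + 1 => forcedTop z b n m :: rayStack z b n m

/-- The TOP ENTRY of the ray stack of depth `m`: the bottom at depth `0`, the ray entry `m − 1` above. -/
def rayTop (z : EuclideanSpace ℝ (Fin 3)) (b : WalkEntry) (n : EuclideanSpace ℝ (Fin 3)) : ℕ → WalkEntry
  | 0 => b
  | m + 1 => forcedTop z b n m

/-- Unfolding, depth `0`. -/
@[simp] theorem rayStack_zero (z : EuclideanSpace ℝ (Fin 3)) (b : WalkEntry) (n : EuclideanSpace ℝ (Fin 3)) :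
    rayStack z b n 0 = [b] := rfl

/-- Unfolding, depth `m + 1`. -/
@[simp] theorem rayStack_succ (z : EuclideanSpace ℝ (Fin 3)) (b : WalkEntry) (n : EuclideanSpace ℝ (Fin 3)) (m : ℕ) :
    rayStack z b n (m + 1) = forcedTop z b n m :: rayStack z b n m := rfl

/-- The ray stack is its top entry consed onto something. -/
theorem rayStack_eq_cons (z : EuclideanSpace ℝ (Fin 3)) (b : WalkEntry) (n : EuclideanSpace ℝ (Fin 3)) :
    ∀ m, ∃ t : List WalkEntry, rayStack z b n m = rayTop z b n m :: t
  | 0 => ⟨[], rfl⟩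
  | m + 1 => ⟨rayStack z b n m, rfl⟩

/-- The ray stack of depth `m` has `m + 1` entries. -/
theorem length_rayStack (z : EuclideanSpace ℝ (Fin 3)) (b : WalkEntry) (n : EuclideanSpace ℝ (Fin 3)) :
    ∀ m, (rayStack z b n m).length = m + 1
  | 0 => rfl
  | m + 1 => by rw [rayStack_succ, List.length_cons, length_rayStack z b n m]

/-- The bottom of the ray stack is `b`. -/
theorem getLast?_rayStack (z : EuclideanSpace ℝ (Fin 3)) (b : WalkEntry) (n : EuclideanSpace ℝ (Fin 3)) :
    ∀ m, (rayStack z b n m).getLast? = some b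
  | 0 => rfl
  | m + 1 => by
    obtain ⟨t, ht⟩ := rayStack_eq_cons z b n m
    rw [rayStack_succ, ht, List.getLast?_cons_cons, ← ht, getLast?_rayStack z b n m]

/-- The FIRST PUSH NORMAL of a stack: the entry normal of the entry just above the bottom (`0` at depth `0`). -/
def firstNrm : List WalkEntry → EuclideanSpace ℝ (Fin 3)
  | [] => 0
  | [_] => 0
  | [e, _] => e.nrm
  | _ :: e' :: e'' :: rest => firstNrm (e' :: e'' :: rest)

/-- **Every sound well-formed stack is a ray stack** (over its bottom, with its own first push normal). -/
theorem stack_eq_rayStack : ∀ (rest : List WalkEntry) (e b : WalkEntry), StackSound z (e :: rest) → StackWF z (e :: rest) →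
    (e :: rest).getLast? = some b → e :: rest = rayStack z b (firstNrm (e :: rest)) rest.length
  | [], e, b, _, _, hl => by
    rw [List.getLast?_singleton, Option.some.injEq] at hl
    rw [hl]; rfl
  | [b'], e, b, hS, hW, hl => by
    have hb : b' = b := by simpa using hl
    subst hb
    obtain ⟨hSo, hLi, -⟩ := hS
    obtain ⟨hdir, -, -⟩ := (stackWF_cons_cons z e b' []).1 hW
    have h := head_eq_pushEntry hSo hLi hdir
    show [e, b'] = [pushEntry z b' e.nrm, b']
    rw [← h]
  | e' :: e'' :: rest, e, b, hS, hW, hl => by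
    obtain ⟨hSo, hLi, hS'⟩ := hS
    obtain ⟨hdir, hne, hW'⟩ := (stackWF_cons_cons z e e' (e'' :: rest)).1 hW
    have hl' : (e' :: e'' :: rest).getLast? = some b := by rw [List.getLast?_cons_cons] at hl; exact hl
    have ih := stack_eq_rayStack (e'' :: rest) e' b hS' hW' hl'
    rw [List.length_cons] at ih
    have he' : e' = forcedTop z b (firstNrm (e' :: e'' :: rest)) rest.length := by
      have := congrArg List.head? ih
      simpa [rayStack_succ] using this
    have hSo' : e'.Sound z := hS'.1
    have hn : e.nrm = nextNormal e' := nrm_eq_nextNormal hSo hLi hSo' hne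
    have h := head_eq_pushEntry hSo hLi hdir
    show e :: e' :: e'' :: rest = forcedTop z b (firstNrm (e' :: e'' :: rest)) (rest.length + 1) ::
      rayStack z b (firstNrm (e' :: e'' :: rest)) (rest.length + 1)
    rw [← ih, forcedTop_succ, ← he', ← hn, ← h]

/-- **The first push normal** of a sound stack of positive depth is a unit menu normal of the bottom frame,
positive on the bottom direction. -/
theorem firstNrm_spec : ∀ (rest : List WalkEntry) (e b : WalkEntry), rest ≠ [] → StackSound z (e :: rest) →
    (e :: rest).getLast? = some b →
    ‖firstNrm (e :: rest)‖ = 1 ∧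
      (∀ w ∈ fccSlots, ⟪b.frame w, firstNrm (e :: rest)⟫_ℝ = 0 ∨ ⟪b.frame w, firstNrm (e :: rest)⟫_ℝ = Real.sqrt (2 / 3) ∨
        ⟪b.frame w, firstNrm (e :: rest)⟫_ℝ = -Real.sqrt (2 / 3)) ∧
      ⟪b.frame b.dir, firstNrm (e :: rest)⟫_ℝ = Real.sqrt (2 / 3)
  | [], _, _, h, _, _ => absurd rfl h
  | [b'], e, b, _, hS, hl => by
    have hb : b' = b := by simpa using hl
    subst hb
    obtain ⟨⟨-, hn, hmenu, -, -, -, -⟩, hLi, -⟩ := hS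
    have hback : ∀ x, b'.frame x = e.frame x - (2 * ⟪e.frame x, e.nrm⟫_ℝ) • e.nrm := twin_symm b'.frame e.frame hn hLi.1
    exact ⟨hn, menu_reflect e.frame b'.frame hn hmenu hback, hLi.2⟩
  | e' :: e'' :: rest, e, b, _, hS, hl => by
    have hl' : (e' :: e'' :: rest).getLast? = some b := by rw [List.getLast?_cons_cons] at hl; exact hl
    exact firstNrm_spec (e'' :: rest) e' b (List.cons_ne_nil _ _) hS.2.2 hl'

/-! ### The ray word -/

/-- The RAY WORD of depth `m`: the model mirror word of the ray stack (most recent letter first). -/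
def rayWord (z : EuclideanSpace ℝ (Fin 3)) (b : WalkEntry) (n : EuclideanSpace ℝ (Fin 3)) (m : ℕ) :
    List (EuclideanSpace ℝ (Fin 3)) :=
  stackWord (rayStack z b n m)

/-- Depth `0`: the empty word. -/
@[simp] theorem rayWord_zero (z : EuclideanSpace ℝ (Fin 3)) (b : WalkEntry) (n : EuclideanSpace ℝ (Fin 3)) :
    rayWord z b n 0 = [] := rfl

/-- Depth `1`: the first push normal pulled back to the bottom frame. -/
theorem rayWord_one (z : EuclideanSpace ℝ (Fin 3)) (b : WalkEntry) (n : EuclideanSpace ℝ (Fin 3)) :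
    rayWord z b n 1 = [b.frame.symm n] := rfl

/-- One more level: the new entry normal pulled back to the previous top frame, consed on. -/
theorem rayWord_succ (z : EuclideanSpace ℝ (Fin 3)) (b : WalkEntry) (n : EuclideanSpace ℝ (Fin 3)) :
    ∀ m, rayWord z b n (m + 1) = (rayTop z b n m).frame.symm (forcedTop z b n m).nrm :: rayWord z b n m
  | 0 => rfl
  | _ + 1 => rfl

/-- The ray word of depth `m` has `m` letters. -/
theorem length_rayWord (z : EuclideanSpace ℝ (Fin 3)) (b : WalkEntry) (n : EuclideanSpace ℝ (Fin 3)) (m : ℕ) :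
    (rayWord z b n m).length = m := by
  obtain ⟨t, ht⟩ := rayStack_eq_cons z b n m
  have hlen := length_rayStack z b n m
  rw [rayWord, ht, length_stackWord_cons]
  rw [ht, List.length_cons] at hlen
  omega

/-- **Longer ray words extend shorter ones at the front.** -/
theorem rayWord_eq_append (z : EuclideanSpace ℝ (Fin 3)) (b : WalkEntry) (n : EuclideanSpace ℝ (Fin 3)) (m : ℕ) :
    ∀ i, ∃ w : List (EuclideanSpace ℝ (Fin 3)), rayWord z b n (m + i) = w ++ rayWord z b n m ∧ w.length = i
  | 0 => ⟨[], by simp⟩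
  | i + 1 => by
    obtain ⟨w, hw, hl⟩ := rayWord_eq_append z b n m i
    refine ⟨(rayTop z b n (m + i)).frame.symm (forcedTop z b n (m + i)).nrm :: w, ?_, by rw [List.length_cons, hl]⟩
    rw [← Nat.add_assoc, rayWord_succ, hw, List.cons_append]

/-! ### The level-`m` word law -/

/-- **The level-`m` law.**  If for every admissible first push normal `n` (unit menu normal of `A`, positive on `u`)
the depth-`|ch|` ray word is not the chain word `ch` as a mirror sequence (`ch ≠ []`), then no sound well-formed
stack over `(A, u, 0)` has a word whose mirror sequence ENDS with that of `ch`. -/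
theorem not_suffix_of_ray {A : EuclideanSpace ℝ (Fin 3) ≃ₗᵢ[ℝ] EuclideanSpace ℝ (Fin 3)} {u : EuclideanSpace ℝ (Fin 3)}
    (ch : List (EuclideanSpace ℝ (Fin 3))) (hch : ch ≠ [])
    (hray : ∀ n : EuclideanSpace ℝ (Fin 3), ‖n‖ = 1 →
      (∀ w ∈ fccSlots, ⟪A w, n⟫_ℝ = 0 ∨ ⟪A w, n⟫_ℝ = Real.sqrt (2 / 3) ∨ ⟪A w, n⟫_ℝ = -Real.sqrt (2 / 3)) →
      ⟪A u, n⟫_ℝ = Real.sqrt (2 / 3) →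
      (rayWord z ⟨A, u, 0⟩ n ch.length).map (fun μ => (ℝ ∙ μ)ᗮ.reflection) ≠ ch.map (fun μ => (ℝ ∙ μ)ᗮ.reflection))
    (rest : List WalkEntry) (e : WalkEntry) (hS : StackSound z (e :: rest)) (hW : StackWF z (e :: rest))
    (hl : (e :: rest).getLast? = some ⟨A, u, 0⟩) :
    ¬ ∃ w, (stackWord (e :: rest)).map (fun μ => (ℝ ∙ μ)ᗮ.reflection) = w ++ ch.map (fun μ => (ℝ ∙ μ)ᗮ.reflection) := by
  rintro ⟨w, hw⟩
  have hlen : ch.length ≤ rest.length := by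
    have := congrArg List.length hw
    rw [List.length_map, length_stackWord_cons, List.length_append, List.length_map] at this
    omega
  have hrest : rest ≠ [] := by
    rintro rfl
    exact hch (by simpa using hlen)
  obtain ⟨hn, hmenu, hpos⟩ := firstNrm_spec rest e ⟨A, u, 0⟩ hrest hS hl
  have hstk := stack_eq_rayStack rest e ⟨A, u, 0⟩ hS hW hl
  obtain ⟨w', hw', hl'⟩ := rayWord_eq_append z ⟨A, u, 0⟩ (firstNrm (e :: rest)) ch.length (rest.length - ch.length)
  rw [Nat.add_sub_cancel' hlen] at hw'
  have hword : stackWord (e :: rest) = w' ++ rayWord z ⟨A, u, 0⟩ (firstNrm (e :: rest)) ch.length := by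
    rw [← hw', rayWord, ← hstk]
  rw [hword, List.map_append] at hw
  have := List.append_inj_right' hw (by rw [List.length_map, List.length_map, length_rayWord])
  exact hray _ hn hmenu hpos this

/-- The forced next normal is a unit vector. -/
theorem norm_nextNormal {e : WalkEntry} (hSo : e.Sound z) : ‖nextNormal e‖ = 1 := by
  obtain ⟨hd, hn, -, hpos, -, -, -⟩ := hSo
  have hc : ‖e.frame e.dir‖ = 1 := by rw [LinearIsometryEquiv.norm_map, norm_eq_one_of_mem_fccSlots hd]
  have h23 : Real.sqrt (2 / 3) * Real.sqrt (2 / 3) = 2 / 3 := Real.mul_self_sqrt (by norm_num)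
  have hsq : ‖nextNormal e‖ ^ 2 = 1 := by
    rw [nextNormal, norm_sub_sq_real, norm_smul, hc, mul_one, inner_smul_left, hpos, hn, Real.norm_eq_abs,
      abs_of_nonneg (by positivity)]
    simp only [RCLike.conj_to_real]
    nlinarith [h23]
  exact (pow_eq_one_iff_of_nonneg (norm_nonneg _) two_ne_zero).1 hsq

/-- **The direction reading of the next level.**  If the word of a sound well-formed stack over `(A, u, 0)` IS the
chain word `ch` (as mirror sequences), `μ` is a unit model menu normal whose mirror differs from that of `ch`'s first
letter, and for every admissible first push normal the depth-`(|ch|+1)` ray word is not `μ :: ch`, then the top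
direction lies in `μ`'s mirror plane. -/
theorem inner_dir_eq_zero_of_ray {A : EuclideanSpace ℝ (Fin 3) ≃ₗᵢ[ℝ] EuclideanSpace ℝ (Fin 3)} {u : EuclideanSpace ℝ (Fin 3)}
    (μ : EuclideanSpace ℝ (Fin 3)) (ch : List (EuclideanSpace ℝ (Fin 3))) (hμ : ‖μ‖ = 1)
    (hμm : ∀ w ∈ fccSlots, ⟪w, μ⟫_ℝ = 0 ∨ ⟪w, μ⟫_ℝ = Real.sqrt (2 / 3) ∨ ⟪w, μ⟫_ℝ = -Real.sqrt (2 / 3))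
    (hμch : ∀ x ∈ ch.head?, (ℝ ∙ μ)ᗮ.reflection ≠ (ℝ ∙ x)ᗮ.reflection)
    (hray : ∀ n : EuclideanSpace ℝ (Fin 3), ‖n‖ = 1 →
      (∀ w ∈ fccSlots, ⟪A w, n⟫_ℝ = 0 ∨ ⟪A w, n⟫_ℝ = Real.sqrt (2 / 3) ∨ ⟪A w, n⟫_ℝ = -Real.sqrt (2 / 3)) →
      ⟪A u, n⟫_ℝ = Real.sqrt (2 / 3) →
      (rayWord z ⟨A, u, 0⟩ n (ch.length + 1)).map (fun μ => (ℝ ∙ μ)ᗮ.reflection) ≠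
        (μ :: ch).map (fun μ => (ℝ ∙ μ)ᗮ.reflection))
    (rest : List WalkEntry) (e : WalkEntry) (hS : StackSound z (e :: rest)) (hW : StackWF z (e :: rest))
    (hl : (e :: rest).getLast? = some ⟨A, u, 0⟩)
    (hword : (stackWord (e :: rest)).map (fun μ => (ℝ ∙ μ)ᗮ.reflection) = ch.map (fun μ => (ℝ ∙ μ)ᗮ.reflection)) :
    ⟪e.dir, μ⟫_ℝ = 0 := by
  have hr : 0 < Real.sqrt (2 / 3) := Real.sqrt_pos.2 (by norm_num)
  have h23 : Real.sqrt (2 / 3) * Real.sqrt (2 / 3) = 2 / 3 := Real.mul_self_sqrt (by norm_num)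
  have hlen : ch.length = rest.length := by
    have := congrArg List.length hword
    rwa [List.length_map, List.length_map, length_stackWord_cons, eq_comm] at this
  cases rest with
  | nil =>
    -- depth 0: the top is the bottom; a push through `±A μ` would make the depth-1 ray word `[±μ]`
    have he : e = ⟨A, u, 0⟩ := by simpa using hl
    subst he
    have hch : ch = [] := List.eq_nil_of_length_eq_zero hlen
    subst hch
    have hAμ : ‖A μ‖ = 1 := by rw [LinearIsometryEquiv.norm_map, hμ]
    have hmenuA : ∀ s : ℝ, (s = 1 ∨ s = -1) → ∀ w ∈ fccSlots, ⟪A w, s • A μ⟫_ℝ = 0 ∨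
        ⟪A w, s • A μ⟫_ℝ = Real.sqrt (2 / 3) ∨ ⟪A w, s • A μ⟫_ℝ = -Real.sqrt (2 / 3) := by
      intro s hs w hw
      rw [inner_smul_right, LinearIsometryEquiv.inner_map_map]
      rcases hs with rfl | rfl
      · simpa using hμm w hw
      · rcases hμm w hw with h | h | h
        · left; rw [h]; ring
        · right; right; rw [h]; ring
        · right; left; rw [h]; ring
    rcases hμm u hS.1 with h0 | hp | hm
    · exact h0
    · exfalso
      refine hray (A μ) hAμ (by simpa using hmenuA 1 (Or.inl rfl))
        (by rw [LinearIsometryEquiv.inner_map_map]; exact hp) ?_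
      show [(A : EuclideanSpace ℝ (Fin 3) ≃ₗᵢ[ℝ] EuclideanSpace ℝ (Fin 3)).symm (A μ)].map _ = _
      rw [LinearIsometryEquiv.symm_apply_apply]
    · exfalso
      have hAμ' : ‖-A μ‖ = 1 := by rw [norm_neg, hAμ]
      refine hray (-A μ) hAμ' (by simpa using hmenuA (-1) (Or.inr rfl))
        (by rw [inner_neg_right, LinearIsometryEquiv.inner_map_map, hm, neg_neg]) ?_
      show [(A : EuclideanSpace ℝ (Fin 3) ≃ₗᵢ[ℝ] EuclideanSpace ℝ (Fin 3)).symm (-A μ)].map _ = _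
      rw [map_neg, LinearIsometryEquiv.symm_apply_apply]; simp [reflection_neg_eq hμ]
  | cons e' rest' =>
    obtain ⟨hSo, hLi, hS'⟩ := hS
    -- the stack is a ray stack; its one-step extension has the word `F⁻¹N :: word`
    set n₀ := firstNrm (e :: e' :: rest') with hn₀
    obtain ⟨hn, hmenu, hpos⟩ := firstNrm_spec (e' :: rest') e ⟨A, u, 0⟩ (List.cons_ne_nil _ _) ⟨hSo, hLi, hS'⟩ hl
    have hstk := stack_eq_rayStack (e' :: rest') e ⟨A, u, 0⟩ ⟨hSo, hLi, hS'⟩ hW hl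
    rw [List.length_cons] at hstk
    have htop : e = forcedTop z ⟨A, u, 0⟩ n₀ rest'.length := by
      have := congrArg List.head? hstk; simpa [rayStack_succ] using this
    have hext : rayWord z ⟨A, u, 0⟩ n₀ (ch.length + 1) = e.frame.symm (nextNormal e) :: stackWord (e :: e' :: rest') := by
      rw [hlen, List.length_cons, rayWord_succ, rayWord, ← hstk]
      show (forcedTop z ⟨A, u, 0⟩ n₀ rest'.length).frame.symm (nextNormal (forcedTop z ⟨A, u, 0⟩ n₀ rest'.length)) :: _ = _
      rw [← htop]
    have hN := hray n₀ hn hmenu hpos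
    rw [hext, List.map_cons, List.map_cons, hword] at hN
    have hNe : (ℝ ∙ e.frame.symm (nextNormal e))ᗮ.reflection ≠ (ℝ ∙ μ)ᗮ.reflection := fun h => hN (by rw [h])
    -- the algebra at the top entry
    obtain ⟨hd, hnn, hmenu_e, hpos_e, -, -, -⟩ := id hSo
    have hFμ : ‖e.frame μ‖ = 1 := by rw [LinearIsometryEquiv.norm_map, hμ]
    have hmenuFμ : ∀ w ∈ fccSlots, ⟪e.frame w, e.frame μ⟫_ℝ = 0 ∨ ⟪e.frame w, e.frame μ⟫_ℝ = Real.sqrt (2 / 3) ∨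
        ⟪e.frame w, e.frame μ⟫_ℝ = -Real.sqrt (2 / 3) := fun w hw => by
      rw [LinearIsometryEquiv.inner_map_map]; exact hμm w hw
    have hNunit : ‖nextNormal e‖ = 1 := norm_nextNormal hSo
    -- `F⁻¹ n_e = −(top letter)`, whose mirror is that of `ch.head`, hence not that of `μ`
    have hch_ne : ch ≠ [] := by rintro rfl; simp at hlen
    obtain ⟨c₀, ch', hch⟩ := List.exists_cons_of_ne_nil hch_ne
    have htopletter : (ℝ ∙ e'.frame.symm e.nrm)ᗮ.reflection = (ℝ ∙ c₀)ᗮ.reflection := by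
      have := congrArg List.head? hword
      rw [stackWord_cons_cons, hch] at this; simpa using this
    have hFn : e.frame.symm e.nrm = -(e'.frame.symm e.nrm) := by
      rw [frame_eq_twinFrame_of_link hnn hLi, twinFrame, LinearIsometryEquiv.symm_trans, LinearIsometryEquiv.trans_apply,
        Submodule.reflection_symm, Submodule.reflection_orthogonalComplement_singleton_eq_neg, map_neg]
    have hnμ : (ℝ ∙ e.frame.symm e.nrm)ᗮ.reflection ≠ (ℝ ∙ μ)ᗮ.reflection := by
      rw [hFn, reflection_neg_eq (by rw [LinearIsometryEquiv.norm_map, hnn]), htopletter]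
      exact fun h => hμch c₀ (by rw [hch]; rfl) h.symm
    -- `t = ⟪n_e, F μ⟫ = ±1/3`
    have ht : ⟪e.nrm, e.frame μ⟫_ℝ = 1 / 3 ∨ ⟪e.nrm, e.frame μ⟫_ℝ = -1 / 3 := by
      have hFn1 : ‖e.frame.symm e.nrm‖ = 1 := by rw [LinearIsometryEquiv.norm_map, hnn]
      rcases inner_menuNormals e.frame hnn hFμ hmenu_e hmenuFμ with h | h | h | h
      · exfalso; apply hnμ
        have : e.nrm = e.frame μ := (inner_eq_one_iff_of_norm_eq_one (𝕜 := ℝ) hnn hFμ).1 h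
        rw [this, LinearIsometryEquiv.symm_apply_apply]
      · exfalso; apply hnμ
        have h' : e.frame μ = -e.nrm := eq_neg_of_inner_eq_neg_one' hnn hFμ h
        have : e.nrm = -e.frame μ := by rw [h', neg_neg]
        rw [this, map_neg, LinearIsometryEquiv.symm_apply_apply, reflection_neg_eq hμ]
      · exact Or.inl h
      · exact Or.inr h
    -- `⟪N, Fμ⟫ = 2√(2/3)·s − t` with `|⟪N, Fμ⟫| ≤ 1`
    have hNFμ : ⟪nextNormal e, e.frame μ⟫_ℝ = 2 * Real.sqrt (2 / 3) * ⟪e.frame e.dir, e.frame μ⟫_ℝ - ⟪e.nrm, e.frame μ⟫_ℝ := by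
      rw [nextNormal, inner_sub_left, inner_smul_left]; simp
    have hCS : |⟪nextNormal e, e.frame μ⟫_ℝ| ≤ 1 := by
      have := abs_real_inner_le_norm (nextNormal e) (e.frame μ); rwa [hNunit, hFμ, one_mul] at this
    have hs : ⟪e.frame e.dir, e.frame μ⟫_ℝ = ⟪e.dir, μ⟫_ℝ := LinearIsometryEquiv.inner_map_map _ _ _
    rcases hμm e.dir hd with h0 | hp | hm
    · exact h0
    · exfalso
      rw [hs, hp] at hNFμ
      rcases ht with ht | ht
      · -- `⟪N, Fμ⟫ = 1`: `N = Fμ`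
        have h1 : ⟪nextNormal e, e.frame μ⟫_ℝ = 1 := by rw [hNFμ, ht]; nlinarith [h23]
        have hEq : nextNormal e = e.frame μ := (inner_eq_one_iff_of_norm_eq_one (𝕜 := ℝ) hNunit hFμ).1 h1
        exact hNe (by rw [hEq, LinearIsometryEquiv.symm_apply_apply])
      · have : ⟪nextNormal e, e.frame μ⟫_ℝ = 5 / 3 := by rw [hNFμ, ht]; nlinarith [h23]
        rw [this] at hCS; norm_num [abs_of_pos] at hCS
    · exfalso
      rw [hs, hm] at hNFμ
      rcases ht with ht | ht
      · have : ⟪nextNormal e, e.frame μ⟫_ℝ = -(5 / 3) := by rw [hNFμ, ht]; nlinarith [h23]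
        rw [this] at hCS; norm_num [abs_of_neg] at hCS
      · have h1 : ⟪nextNormal e, e.frame μ⟫_ℝ = -1 := by rw [hNFμ, ht]; nlinarith [h23]
        have hEq' : e.frame μ = -nextNormal e := eq_neg_of_inner_eq_neg_one' hNunit hFμ h1
        have hEq : nextNormal e = -e.frame μ := by rw [hEq', neg_neg]
        exact hNe (by rw [hEq, map_neg, LinearIsometryEquiv.symm_apply_apply, reflection_neg_eq hμ])

end Summit.Ventures.Crystal3D.Theorems

end
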